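import Mathlib
import Summits.NavierStokesRegularity.NavierStokesRegularity.Theorems.ScaledTopAlignmentFlexibleZoomDiagLU
import Summits.NavierStokesRegularity.NavierStokesRegularity.Theorems.ScaledTopAlignmentMostTimesEnd
import Summits.NavierStokesRegularity.NavierStokesRegularity.Theorems.LocalSineTubeDoorProfileAlignedWindowRigidity
import Summits.NavierStokesRegularity.NavierStokesRegularity.Theorems.ClockStretchingLawClockCeilingSingularStretchingNearZero
import Summits.NavierStokesRegularity.NavierStokesRegularity.Theorems.ScaledTopAlignmentDirectionGradientMostTimesSelection
import Literature.Analysis.FluidPDE.VorticityCalculus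
import HarnessLib

/-!
# Route `ScaledTopAlignment`: the MOST-TIMES form of Giga–Miura 2011, Cor. 2.6 — the square-integrable
# sup bound on `∇ξ` over the top region is only required OFF an exceptional time set of final density
# `< 1` (support for the deciding crux W3ᵐᵗ = `AprioriMostTimesBulkAlignment`, stmt-NavierStokesRegularity-19551;
# no import of the route file)

Giga–Miura 2011, Cor. 2.6 (HUPS #956 p. 9; tree `hasSmoothExtensionPast_of_directionGradient_sqIntegrable_typeI`)
assumes `‖∇ξ(t,x)‖ ≤ g(t)` on `Ω_d(t) = {|ω(t,·)| > d}` for ALL `t ∈ (0, T)`, `∫ g² < ∞`. The route's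
door W3ᵐᵗ (stmt-19551) asks its window clause only at times `t ∉ E`, `E` an exceptional set of final
density `≤ θ < 1` at `T` (`volume (E ∩ (T−h, T)) ≤ θ h` for small `h`). This module proves Cor. 2.6
WITH THAT TIME STRUCTURE (`hasSmoothExtensionPast_of_directionGradient_sqIntegrable_mostTimes_typeI`):
Type I + [`‖∇ξ(t,x)‖ ≤ g(t)` for `t ∈ (0,T) ∖ E`, `|ω(t,x)| > d`] + `∫_{(0,T)} g² < ∞` ⇒ continuation;
nothing at all is assumed at the times in `E` (take `E = ∅` for Cor. 2.6).

Proof (`false_of_directionGradient_sqIntegrable_mostTimes_typeI`): the flexible Type-I zoom with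
locally uniform convergence along DIAGONAL slices (`typeIZoom_ancientMild_limit_flexible_diagLocUnif`);
a non-unidirectional end `s < t₁` (`exists_end_curl_not_unidirectional`); the slice selection off `E`
(`exists_slices_notMem_sq_le_of_sqIntegrable`: slices `σ_j ∈ (a, b)`, `b = 2t₁`, with physical times
`T + λ_j² σ_j/ν ∉ E` and scaled majorants `(λ_j g(T + λ_j² σ_j/ν))² ≤ δ_j → 0` — Markov on the `L²`
tail plus the density bound); a convergent subsequence `σ_{ψ i} → s⋆ ≤ b < t₁`; on a ball where
`|curl W(s⋆)| > 0` the zoomed direction fields along the slices `σ_{ψ i}` are `λ g`-Lipschitz (mean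
value inside the top region, reached thanks to the diagonal local uniformity) with constants `→ 0`, so
the limit direction is constant on the ball; LocalSineTubeDoor's `eq_zero_of_aligned_window` kills `W`.
WHAT THIS IS NOT: not NS regularity — a Type-I-CONDITIONAL criterion (a printed one with a weaker time
hypothesis); it does not prove W3ᵐᵗ and leaves the residual NoTypeII (stmt-0056) untouched.

## References
* Y. Giga, H. Miura, Comm. Math. Phys. 303 (2011) 289–300 = HUPS #956: Cor. 2.6, Rmk. 2.7 (p. 9).
  [GigaMiura2011]
* G. Koch, N. Nadirashvili, G. Seregin, V. Šverák, Acta Math. 203 (2009) 83–105: Prop. 4.1 / (4.11),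
  Lemma 6.1, §6. [KochNadirashviliSereginSverak2009]
-/

noncomputable section

-- the summit and its single sub-problem share the name (CONVENTIONS §1), as in every Theorems file
set_option linter.dupNamespace false

open MeasureTheory Set Function Filter Topology Metric
open scoped RealInnerProductSpace ENNReal NNReal

namespace Summit.NavierStokesRegularity.NavierStokesRegularity.Theorems

open Literature.Analysis Literature.Analysis.FluidPDE
open Summit.NavierStokesRegularity.NavierStokesRegularity.Theorems.LocalSineTubeDoorProfileAlignedWindowRigidity

set_option maxHeartbeats 1600000 in
/-- **A square-integrable-in-time `L^∞(Ω_d)` bound on `∇ξ` OFF an exceptional time set of final density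
`< 1` kills Type-I blow-up** (most-times form of Giga–Miura 2011, Cor. 2.6). Let `(u, p)` be a classical
solution on `ℝ³ × [0, T)`, Leray–Hopf from `u 0`, bounded on every `[0, T'] × ℝ³` (`T' < T`), with the
Type-I rate at `T` and no smooth extension past `T`; let `d > 0`, `θ < 1`, `E ⊆ ℝ` with
`volume (E ∩ (T−h, T)) ≤ θ h` for `0 < h < h₀`, and `g : ℝ → [0,∞]` measurable with `∫_{(0,T)} g² < ∞`
and `‖D(ξ(t))(x)‖ₑ ≤ g t` whenever `t ∈ (0,T) ∖ E` and `|ω(t,x)| > d`. Then `False`.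
[cite: GigaMiura2011, Cor. 2.6 with Rmk. 2.7 (§2.1; HUPS preprint #956 p. 9)] -/
theorem false_of_directionGradient_sqIntegrable_mostTimes_typeI {ν T : ℝ} (hν : 0 < ν) (hT : 0 < T)
    {u : ℝ → EuclideanSpace ℝ (Fin 3) → EuclideanSpace ℝ (Fin 3)}
    {p : ℝ → EuclideanSpace ℝ (Fin 3) → ℝ}
    (hsol : IsClassicalNSSolutionOn (Ico 0 T) ν 0 u p) (hLH : IsLerayHopfOn T ν 0 (u 0) u)
    (hslab : ∀ T' < T, ∃ M : ℝ, ∀ t ∈ Icc 0 T', ∀ x, ‖u t x‖ ≤ M)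
    (hI : IsTypeIBlowup u T) (hext : ¬ HasSmoothExtensionPast ν 0 u T)
    {θ : ℝ} (hθ : θ < 1) {d : ℝ} (hd : 0 < d) {g : ℝ → ℝ≥0∞} (hgm : Measurable g)
    (hg2 : (∫⁻ t in Ioo 0 T, g t ^ 2) < ∞) {E : Set ℝ}
    (hE : ∃ h0 : ℝ, 0 < h0 ∧ ∀ h : ℝ, 0 < h → h < h0 →
      volume (E ∩ Ioo (T - h) T) ≤ ENNReal.ofReal (θ * h))
    (hDξ : ∀ t ∈ Ioo 0 T, t ∉ E → ∀ x : EuclideanSpace ℝ (Fin 3), d < ‖curl (u t) x‖ →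
      ‖fderiv ℝ (vorticityDirection (curl (u t))) x‖ₑ ≤ g t) : False := by
  classical
  -- Step 1: the flexible zoom with diagonal locally uniform slice convergence, base times `τ_j = T - T/(j+2)`
  set τ : ℕ → ℝ := fun j => T - T / ((j : ℝ) + 2) with hτdef
  have hτ : ∀ j, τ j ∈ Ico 0 T := fun j => by
    have h2 : (0 : ℝ) < (j : ℝ) + 2 := by positivity
    have h3 : T / ((j : ℝ) + 2) ≤ T := by
      rw [div_le_iff₀ h2]; nlinarith [(Nat.cast_nonneg j : (0 : ℝ) ≤ j)]
    have h4 : 0 < T / ((j : ℝ) + 2) := div_pos hT h2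
    simp only [hτdef, mem_Ico]
    constructor <;> linarith
  have hτT : Tendsto τ atTop (𝓝 T) := by
    have h1 : Tendsto (fun j : ℕ => T / ((j : ℝ) + 2)) atTop (𝓝 0) := by
      have h := (tendsto_one_div_add_atTop_nhds_zero_nat (𝕜 := ℝ)).comp (tendsto_add_atTop_nat 1)
      have h' : Tendsto (fun j : ℕ => T * (1 / ((j : ℝ) + 2))) atTop (𝓝 (T * 0)) := by
        refine (h.congr fun j => ?_).const_mul T
        simp only [comp_apply, Nat.cast_add, Nat.cast_one]
        ring
      rw [mul_zero] at h'
      exact h'.congr fun j => by ring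
    have h2 := h1.const_sub T
    rw [sub_zero] at h2
    exact h2
  obtain ⟨φ, -, C, W, xc, lam, hWcl, hW0, hlam, -, hlam0, -, hflex, hLU⟩ :=
    typeIZoom_ancientMild_limit_flexible_diagLocUnif hν hT hsol hLH hslab hI hext hτ hτT
  have hc : ∀ j, 0 < lam j ^ 2 / ν := fun j => div_pos (pow_pos (hlam j) 2) hν
  have hc0 : Tendsto (fun j => lam j ^ 2 / ν) atTop (𝓝 0) := by
    have h := (hlam0.pow 2).div_const ν
    rw [zero_pow two_ne_zero, zero_div] at h
    exact h
  -- Step 2: a non-unidirectional vorticity end `s < t₁` of `W`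
  obtain ⟨t₁, ht₁, hend⟩ := exists_end_curl_not_unidirectional hWcl ⟨-1, by norm_num, 0, hW0⟩
  have hnz : ∀ s < t₁, ∃ y, curl (W s) y ≠ 0 := fun s hs => by
    by_contra h
    push Not at h
    refine hend s hs ⟨EuclideanSpace.single 0 1, fun h0 => ?_, fun y => ⟨0, by rw [h y, zero_smul]⟩⟩
    simpa using congr_arg (fun v : EuclideanSpace ℝ (Fin 3) => v 0) h0
  -- Step 3: slices `σ_j ∈ (a, b)`, `b = 2t₁`, off `E` with scaled majorants `≤ δ_j → 0`; a convergent
  -- subsequence `σ (ψ i) → s⋆ ∈ [a, b]`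
  set b : ℝ := 2 * t₁ with hbdef
  have hb0 : b < 0 := by rw [hbdef]; linarith
  have hbt₁ : b < t₁ := by rw [hbdef]; linarith
  obtain ⟨a, hab, σ, δ, hδ0, hsel⟩ :=
    exists_slices_notMem_sq_le_of_sqIntegrable (T := T) hν hT hθ hgm hg2 hlam hlam0 hE hb0
  set σ' : ℕ → ℝ := fun j => max a (min b (σ j)) with hσ'def
  have hσ'mem : ∀ j, σ' j ∈ Icc a b := fun j =>
    ⟨le_max_left _ _, max_le hab.le (min_le_left _ _)⟩
  have hσ'eq : ∀ j, σ j ∈ Ioo a b → σ' j = σ j := fun j hj => by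
    simp only [hσ'def]; rw [min_eq_right hj.2.le, max_eq_right hj.1.le]
  obtain ⟨sStar, hsStar, ψ, hψ, hσlim⟩ := isCompact_Icc.tendsto_subseq hσ'mem
  have hs0 : sStar < 0 := lt_of_le_of_lt hsStar.2 hb0
  have hst₁ : sStar < t₁ := lt_of_le_of_lt hsStar.2 hbt₁
  have hψt : Tendsto ψ atTop atTop := hψ.tendsto_atTop
  -- the selected slices along `ψ`, extended off the range of `ψ` by `s⋆`
  set ρ : ℕ → ℝ := Function.extend ψ (fun i => σ (ψ i)) fun _ => sStar with hρdef
  have hρψ : ∀ i, ρ (ψ i) = σ (ψ i) := fun i => by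
    simp only [hρdef, hψ.injective.extend_apply]
  have hσψ : Tendsto (fun i => σ (ψ i)) atTop (𝓝 sStar) := by
    refine hσlim.congr' ?_
    filter_upwards [hψt.eventually hsel] with i hi
    exact (hσ'eq (ψ i) hi.1)
  have hρ : Tendsto ρ atTop (𝓝 sStar) := tendsto_extend_of_strictMono hψ hσψ
  -- Step 4: the slice `s⋆`: a ball on which the limit vorticity stays away from zero
  set Ω : EuclideanSpace ℝ (Fin 3) → EuclideanSpace ℝ (Fin 3) := curl (W sStar) with hΩdef
  obtain ⟨y₀, hy₀⟩ := hnz sStar hst₁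
  have hΩc : Continuous Ω :=
    continuous_curl ((hWcl.contDiff_slice hs0).of_le (by exact_mod_cast le_top))
  set m₀ : ℝ := ‖Ω y₀‖ with hm₀def
  have hm₀ : 0 < m₀ := norm_pos_iff.2 hy₀
  obtain ⟨r, hr, hball⟩ : ∃ r : ℝ, 0 < r ∧ ∀ y ∈ closedBall y₀ r, ‖Ω y - Ω y₀‖ < m₀ / 4 := by
    obtain ⟨δ', hδ', hδ''⟩ := Metric.continuousAt_iff.1 hΩc.continuousAt (m₀ / 4) (by positivity)
    refine ⟨δ' / 2, by positivity, fun y hy => ?_⟩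
    rw [← dist_eq_norm]
    exact hδ'' (lt_of_le_of_lt (mem_closedBall.1 hy) (by linarith))
  have hΩne : ∀ y ∈ closedBall y₀ r, 3 * m₀ / 4 < ‖Ω y‖ := fun y hy => by
    have h2 : ‖Ω y₀‖ - ‖Ω y‖ ≤ ‖Ω y - Ω y₀‖ := by
      rw [← norm_neg (Ω y - Ω y₀), neg_sub]; exact norm_sub_norm_le _ _
    linarith [hball y hy]
  have hΩne' : ∀ y ∈ closedBall y₀ r, Ω y ≠ 0 := fun y hy => norm_pos_iff.1 (by linarith [hΩne y hy])
  -- the vorticity zooms along the selected slices, their physical times and direction fields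
  set F : ℕ → EuclideanSpace ℝ (Fin 3) → EuclideanSpace ℝ (Fin 3) := fun i y =>
    (lam (ψ i) ^ 2 / ν) • curl (u (T + lam (ψ i) ^ 2 * σ (ψ i) / ν)) (xc (ψ i) + lam (ψ i) • y)
    with hFdef
  set tt : ℕ → ℝ := fun i => T + lam (ψ i) ^ 2 * σ (ψ i) / ν with httdef
  have htt : ∀ i, T + lam (ψ i) ^ 2 / ν * σ (ψ i) = tt i := fun i => by rw [httdef]; ring
  set ζ : ℕ → EuclideanSpace ℝ (Fin 3) → EuclideanSpace ℝ (Fin 3) := fun i y =>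
    vorticityDirection (curl (u (tt i))) (xc (ψ i) + lam (ψ i) • y) with hζdef
  -- diagonal convergence along `ψ`: locally uniform (for the top region) and pointwise (directions)
  have hGU : TendstoUniformlyOn
      (fun j y => (lam j ^ 2 / ν) • curl (u (T + lam j ^ 2 * ρ j / ν)) (xc j + lam j • y)) Ω atTop
      (closedBall y₀ r) :=
    (tendstoLocallyUniformly_iff_forall_isCompact.1 (hLU sStar hs0 ρ hρ)) _ (isCompact_closedBall _ _)
  have hev1 : ∀ᶠ i in atTop, ∀ y ∈ closedBall y₀ r, m₀ / 2 < ‖F i y‖ := by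
    have h := hψt.eventually (Metric.tendstoUniformlyOn_iff.1 hGU (m₀ / 4) (by positivity))
    filter_upwards [h] with i hi y hy
    have h1 := hi y hy
    rw [hρψ i, dist_eq_norm] at h1
    have h3 : ‖Ω y‖ ≤ ‖Ω y - F i y‖ + ‖F i y‖ := by
      calc ‖Ω y‖ = ‖(Ω y - F i y) + F i y‖ := by rw [sub_add_cancel]
        _ ≤ ‖Ω y - F i y‖ + ‖F i y‖ := norm_add_le _ _
    linarith [hΩne y hy]
  have hconv : ∀ y, Tendsto (fun i => F i y) atTop (𝓝 (Ω y)) := by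
    intro y
    have h := (hflex sStar hs0 ρ hρ y).comp hψt
    refine h.congr fun i => ?_
    simp only [comp_apply, hFdef, hρψ i]
  have hev2 : ∀ᶠ i in atTop, lam (ψ i) ^ 2 / ν * d < m₀ / 2 := by
    have h1 : Tendsto (fun j => lam j ^ 2 / ν * d) atTop (𝓝 (0 * d)) := hc0.mul_const d
    rw [zero_mul] at h1
    exact hψt.eventually (h1.eventually_lt_const (by positivity))
  have hev3 : ∀ᶠ i in atTop, tt i ∈ Ioo 0 T := by
    have h1 : Tendsto (fun j => lam j ^ 2 / ν * (-a)) atTop (𝓝 (0 * (-a))) := hc0.mul_const _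
    rw [zero_mul] at h1
    filter_upwards [hψt.eventually (h1.eventually_lt_const hT), hψt.eventually hsel] with i hi hs
    have hsa : a < σ (ψ i) := hs.1.1
    have hsb : σ (ψ i) < b := hs.1.2
    have h2 : lam (ψ i) ^ 2 / ν * σ (ψ i) < 0 := mul_neg_of_pos_of_neg (hc _) (hsb.trans hb0)
    have h4 : lam (ψ i) ^ 2 / ν * a < lam (ψ i) ^ 2 / ν * σ (ψ i) := mul_lt_mul_of_pos_left hsa (hc _)
    rw [← htt i]
    exact ⟨by nlinarith, by linarith⟩
  -- the scaled majorants along `ψ` tend to zero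
  set H : ℕ → ℝ≥0∞ := fun i => ENNReal.ofReal (lam (ψ i)) * g (T + lam (ψ i) ^ 2 / ν * σ (ψ i)) with hHdef
  have hH0 : Tendsto (fun i => (H i).toReal) atTop (𝓝 0) := by
    have hsq : Tendsto (fun i => H i ^ 2) atTop (𝓝 0) := by
      refine tendsto_of_tendsto_of_tendsto_of_le_of_le' tendsto_const_nhds (hδ0.comp hψt)
        (Eventually.of_forall fun _ => zero_le) ?_
      filter_upwards [hψt.eventually hsel] with i hi
      exact hi.2.2
    have hroot : Tendsto (fun i => (H i ^ 2) ^ ((2 : ℕ)⁻¹ : ℝ)) atTop (𝓝 ((0 : ℝ≥0∞) ^ ((2 : ℕ)⁻¹ : ℝ))) :=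
      (ENNReal.continuous_rpow_const.tendsto 0).comp hsq
    rw [ENNReal.zero_rpow_of_pos (by norm_num)] at hroot
    have hH : Tendsto H atTop (𝓝 0) := by
      refine hroot.congr fun i => ?_
      exact ENNReal.pow_rpow_inv_natCast two_ne_zero (H i)
    have h := (ENNReal.tendsto_toReal ENNReal.zero_ne_top).comp hH
    rwa [ENNReal.toReal_zero] at h
  -- Step 5: on the good indices the zoomed direction field is `H i`-Lipschitz on the ball
  have hgood : ∀ᶠ i in atTop, ∀ y ∈ closedBall y₀ r, ‖ζ i y - ζ i y₀‖ ≤ (H i).toReal * r := by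
    filter_upwards [hev1, hev2, hev3, hψt.eventually hsel,
      hψt.eventually (hδ0.eventually_lt_const one_pos)] with i h1 h2 h3 hs hδ1 y hy
    have hnotE : tt i ∉ E := by rw [← htt i]; exact hs.2.1
    -- `g (tt i)` is finite
    have hHi : H i = ENNReal.ofReal (lam (ψ i)) * g (tt i) := by
      simp only [hHdef]; rw [htt i]
    have hlami : ENNReal.ofReal (lam (ψ i)) ≠ 0 := (ENNReal.ofReal_pos.2 (hlam _)).ne'
    have hHtop : H i ≠ ⊤ := by
      intro htop
      have h : H i ^ 2 ≤ δ (ψ i) := hs.2.2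
      rw [htop, ENNReal.top_pow two_ne_zero, top_le_iff] at h
      rw [h] at hδ1
      exact absurd hδ1 (not_lt.2 le_top)
    have hgfin : g (tt i) ≠ ∞ := by
      intro htop
      rw [hHi, htop, ENNReal.mul_top hlami] at hHtop
      exact hHtop rfl
    have hHreal : (H i).toReal = lam (ψ i) * (g (tt i)).toReal := by
      rw [hHi, ENNReal.toReal_mul, ENNReal.toReal_ofReal (hlam _).le]
    -- the ball's preimage lies in the top region `Ω_d(tt i)`
    have htop : ∀ z ∈ closedBall y₀ r, d < ‖curl (u (tt i)) (xc (ψ i) + lam (ψ i) • z)‖ := by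
      intro z hz
      have hF := h1 z hz
      have e : ‖F i z‖ = lam (ψ i) ^ 2 / ν * ‖curl (u (tt i)) (xc (ψ i) + lam (ψ i) • z)‖ := by
        simp only [hFdef, httdef]
        rw [norm_smul, Real.norm_of_nonneg (hc _).le]
      rw [e] at hF
      exact lt_of_mul_lt_mul_left (h2.trans hF) (hc _).le
    -- differentiability of the direction field there, with the derivative bound
    have hmem : tt i ∈ Ico 0 T := ⟨h3.1.le, h3.2⟩
    have hωdiff : Differentiable ℝ (curl (u (tt i))) :=
      (contDiff_curl (n := 1) ((hsol.contDiff_velocity hmem).of_le (by exact_mod_cast le_top))).differentiable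
        (by simp)
    have hξdiff : ∀ z ∈ closedBall y₀ r,
        DifferentiableAt ℝ (vorticityDirection (curl (u (tt i)))) (xc (ψ i) + lam (ψ i) • z) :=
      fun z hz => differentiableAt_vorticityDirection (hωdiff _) (norm_pos_iff.1 (hd.trans (htop z hz)))
    have hξbd : ∀ z ∈ closedBall y₀ r,
        ‖fderiv ℝ (vorticityDirection (curl (u (tt i)))) (xc (ψ i) + lam (ψ i) • z)‖ ≤
          (g (tt i)).toReal := by
      intro z hz
      have h := ENNReal.toReal_mono hgfin (hDξ (tt i) h3 hnotE _ (htop z hz))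
      rwa [toReal_enorm] at h
    have hζder : ∀ z ∈ closedBall y₀ r, HasFDerivAt (ζ i)
        ((fderiv ℝ (vorticityDirection (curl (u (tt i)))) (xc (ψ i) + lam (ψ i) • z)).comp
          (lam (ψ i) • ContinuousLinearMap.id ℝ (EuclideanSpace ℝ (Fin 3)))) z := by
      intro z hz
      have haff : HasFDerivAt (fun y : EuclideanSpace ℝ (Fin 3) => xc (ψ i) + lam (ψ i) • y)
          (lam (ψ i) • ContinuousLinearMap.id ℝ (EuclideanSpace ℝ (Fin 3))) z :=
        ((hasFDerivAt_id z).const_smul (lam (ψ i))).const_add (xc (ψ i))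
      exact (hξdiff z hz).hasFDerivAt.comp z haff
    have hζbd : ∀ z ∈ closedBall y₀ r, ‖fderiv ℝ (ζ i) z‖ ≤ (g (tt i)).toReal * lam (ψ i) := by
      intro z hz
      rw [(hζder z hz).fderiv]
      refine (ContinuousLinearMap.opNorm_comp_le _ _).trans ?_
      refine mul_le_mul (hξbd z hz) ?_ (norm_nonneg _) ENNReal.toReal_nonneg
      rw [norm_smul, Real.norm_of_nonneg (hlam _).le]
      have := ContinuousLinearMap.norm_id_le (𝕜 := ℝ) (E := EuclideanSpace ℝ (Fin 3))
      nlinarith [(hlam (ψ i)).le]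
    -- mean value on the convex ball
    have hmv : ‖ζ i y - ζ i y₀‖ ≤ (g (tt i)).toReal * lam (ψ i) * ‖y - y₀‖ :=
      (convex_closedBall y₀ r).norm_image_sub_le_of_norm_fderiv_le
        (fun z hz => (hζder z hz).differentiableAt) hζbd (mem_closedBall_self hr.le) hy
    have hyr : ‖y - y₀‖ ≤ r := by rw [← dist_eq_norm]; exact mem_closedBall.1 hy
    have hCnn : 0 ≤ (g (tt i)).toReal * lam (ψ i) := mul_nonneg ENNReal.toReal_nonneg (hlam _).le
    calc ‖ζ i y - ζ i y₀‖ ≤ (g (tt i)).toReal * lam (ψ i) * ‖y - y₀‖ := hmv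
      _ ≤ (g (tt i)).toReal * lam (ψ i) * r := mul_le_mul_of_nonneg_left hyr hCnn
      _ = (H i).toReal * r := by rw [hHreal, mul_comm (lam (ψ i))]
  -- the zoomed directions converge to the direction of the limit vorticity on the ball
  have hζlim : ∀ y ∈ closedBall y₀ r, Tendsto (fun i => ζ i y) atTop (𝓝 (‖Ω y‖⁻¹ • Ω y)) := by
    intro y hy
    have hnd : ContinuousAt (fun v : EuclideanSpace ℝ (Fin 3) => ‖v‖⁻¹ • v) (Ω y) :=
      (continuous_norm.continuousAt.inv₀ (norm_ne_zero_iff.2 (hΩne' y hy))).smul continuousAt_id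
    refine (hnd.tendsto.comp (hconv y)).congr fun i => ?_
    show ‖F i y‖⁻¹ • F i y = ζ i y
    simp only [hFdef, hζdef, httdef, vorticityDirection_apply]
    exact inv_norm_smul_smul_of_pos (hc _) _
  -- hence the limit directions agree on the ball
  have hpar : ∀ y ∈ closedBall y₀ r, ‖Ω y‖⁻¹ • Ω y = ‖Ω y₀‖⁻¹ • Ω y₀ := by
    intro y hy
    set D : ℝ := ‖‖Ω y‖⁻¹ • Ω y - ‖Ω y₀‖⁻¹ • Ω y₀‖ with hDdef
    have hDlim : Tendsto (fun i => ‖ζ i y - ζ i y₀‖) atTop (𝓝 D) :=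
      ((hζlim y hy).sub (hζlim y₀ (mem_closedBall_self hr.le))).norm
    have hbd : Tendsto (fun i => (H i).toReal * r) atTop (𝓝 0) := by
      simpa using hH0.mul_const r
    have hD0 : D ≤ 0 := le_of_tendsto_of_tendsto hDlim hbd (hgood.mono fun i hi => hi y hy)
    exact sub_eq_zero.1 (norm_eq_zero.1 (le_antisymm hD0 (norm_nonneg _)))
  -- Step 6: `curl W(s⋆)` is parallel to `Ω y₀` on the open ball — window rigidity kills `W`
  have hal : ∀ y ∈ ball y₀ r, cross (curl (W sStar) y) (Ω y₀) = 0 := by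
    intro y hy
    have hy' : y ∈ closedBall y₀ r := ball_subset_closedBall hy
    have hΩy : Ω y ≠ 0 := hΩne' y hy'
    have e1 : Ω y = (‖Ω y‖ * ‖Ω y₀‖⁻¹) • Ω y₀ := by
      calc Ω y = ‖Ω y‖ • (‖Ω y‖⁻¹ • Ω y) := by rw [smul_inv_smul₀ (norm_ne_zero_iff.2 hΩy)]
        _ = ‖Ω y‖ • (‖Ω y₀‖⁻¹ • Ω y₀) := by rw [hpar y hy']
        _ = (‖Ω y‖ * ‖Ω y₀‖⁻¹) • Ω y₀ := by rw [mul_smul]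
    show cross (Ω y) (Ω y₀) = 0
    rw [e1]
    ext i
    fin_cases i <;> (simp [cross]; try ring)
  exact hW0 (eq_zero_of_aligned_window hWcl.hasTypeITimeDecay hWcl.continuousOn_uncurry
    (fun s t hst ht' x => hWcl.mild_eq_heatExtension hst ht' x) (fun t ht' => hWcl.isDivFree ht')
    hs0 hy₀ isOpen_ball ⟨y₀, mem_ball_self hr⟩ hal (-1) (by norm_num) 0)

/-- **Giga–Miura 2011, Cor. 2.6, most-times form — PROVED.** Let `ν > 0`, `T > 0`, and let `(u, p)`
be a classical unforced Navier–Stokes solution on `ℝ³ × [0, T)` which is Leray–Hopf on `[0, T)` and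
bounded on `ℝ³ × [0, T']` for every `T' < T`, with a possible blow-up at `T` of Type I
(`IsTypeIBlowup u T`). Suppose that for some `d > 0`, some `θ < 1`, some exceptional time set `E` of
final density `≤ θ` at `T` (`volume (E ∩ (T−h, T)) ≤ θ h` for `0 < h < h₀`) and some measurable
`g : ℝ → [0, ∞]` with `∫_{(0,T)} g² < ∞`: `‖∇ξ(t, x)‖ ≤ g(t)` for every `t ∈ (0, T) ∖ E` and every `x`
with `|ω(t,x)| > d` (`ξ = ω/|ω|`; nothing is assumed at the times in `E`). Then `u` continues as a
classical solution past `T`. Cor. 2.6 (`hasSmoothExtensionPast_of_directionGradient_sqIntegrable_typeI`)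
is the case `E = ∅`. [cite: GigaMiura2011, Cor. 2.6 with Rmk. 2.7 (§2.1; HUPS preprint #956 p. 9)] -/
theorem hasSmoothExtensionPast_of_directionGradient_sqIntegrable_mostTimes_typeI {ν T : ℝ}
    (hν : 0 < ν) (hT : 0 < T) {u : ℝ → EuclideanSpace ℝ (Fin 3) → EuclideanSpace ℝ (Fin 3)}
    {p : ℝ → EuclideanSpace ℝ (Fin 3) → ℝ}
    (hsol : IsClassicalNSSolutionOn (Ico 0 T) ν 0 u p) (hLH : IsLerayHopfOn T ν 0 (u 0) u)
    (hbdd : ∀ T' < T, ∃ M : ℝ, ∀ t ∈ Icc 0 T', ∀ x, ‖u t x‖ ≤ M)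
    (hI : IsTypeIBlowup u T)
    (hD : ∃ d : ℝ, 0 < d ∧ ∃ θ : ℝ, θ < 1 ∧ ∃ E : Set ℝ, (∃ h0 : ℝ, 0 < h0 ∧ ∀ h : ℝ, 0 < h →
      h < h0 → volume (E ∩ Ioo (T - h) T) ≤ ENNReal.ofReal (θ * h)) ∧
      ∃ g : ℝ → ℝ≥0∞, Measurable g ∧ (∫⁻ t in Ioo 0 T, g t ^ 2) < ∞ ∧
        ∀ t ∈ Ioo 0 T, t ∉ E → ∀ x : EuclideanSpace ℝ (Fin 3), d < ‖curl (u t) x‖ →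
          ‖fderiv ℝ (vorticityDirection (curl (u t))) x‖ₑ ≤ g t) :
    HasSmoothExtensionPast ν 0 u T := by
  obtain ⟨d, hd, θ, hθ, E, hE, g, hgm, hg2, hDξ⟩ := hD
  by_contra hext
  exact false_of_directionGradient_sqIntegrable_mostTimes_typeI hν hT hsol hLH hbdd hI hext hθ hd hgm
    hg2 hE hDξ

end Summit.NavierStokesRegularity.NavierStokesRegularity.Theorems

end
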